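import Summits.CriticalPhenomena.SAWScalingLimit.Theorems.SAWDefectDecoherenceMassRatioRenewalDefs

/-!
# Crux `SAWDefectDecoherence.MassRatio` (stmt-CriticalPhenomena-8550), line
`renewal-averaging-at-b`: the block module (stub `stub_blockModule`)

The finitary heart of the b-side module of the line: Kesten's renewal identity for bridges and
irreducible bridges, iterated, plus block counting — with NO measure theory and no `I(x_c) = 1`.
Everything about walks enters through the two hypotheses `BridgeDictionary kernel HV.stripBlim`
(translation invariance, window monotonicity, identification of `sup_W` confined bridges with
`B_h = HV.stripBlim h`, vanishing off the sublattice of genuine top edges) and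
`RenewalSurgery kernel` (the two finite concatenation / splitting inequalities); the file only
manipulates real numbers, suprema and finite sums.

* Part A (`BlockModule.block_algebra`, pure real sequences): if
  `B_s = I_s + Σ_{k=1}^{s-1} B_k I_{s-k}` (`s ≥ 1`), then by induction
  `B_s = a_n(s) + Σ_{k=1}^{s-n-1} B_k a_n(s-k)` with `a_n(h) = I_h + Σ_{k=1}^{n} B_k I_{h-k}`
  (`BlockModule.iterate`); summing over `s ∈ [t, 2t]` (`t = n + 1`) and swapping gives
  `Σ_{s=t}^{2t} B_s ≤ (Σ_{h=t}^{2t} a_n(h)) (1 + Σ_{s=1}^{t} B_s)`, so the block hypothesis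
  `p₀ Σ_{s ≤ t} B_s ≤ Σ_{s=t}^{2t} B_s` forces `Σ_h a_n(h) ≥ p₀ B_1 / (1 + B_1)`.
* Part B (limits `V → ∞`): the confined masses `bridgeMassOf kernel 0 0 k V ↑ B_k` and
  `irrMassOf kernel 0 0 n V ↑ I_n := sup_V`; surgery (A) at `t = h = s` and surgery (B) give the
  renewal equation (`BlockModule.renewal`); surgery (A) summed over `h ∈ [t, 2t]` bounds
  `boxMass 0 0 t (2V)` below by a finite window converging to `Σ_h a_{t-1}(h)`; translation
  invariance transports the bound to every door.

Sources: H. Kesten, J. Math. Phys. 4 (1963) 960–969; N. Madras, G. Slade, *The Self-Avoiding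
Walk* (1993) §4.2, (4.2.4)–(4.2.5) (the renewal theorem is not needed: the second-moment bound is
replaced by the exact block identity of Part A).
-/

noncomputable section

namespace Summit.CriticalPhenomena.SAWScalingLimit.Theorems.MassRatio.Renewal

open Filter Topology
open Literature.Probability.LatticeModels Literature.Probability.RandomPlanarGeometry
open Literature.Probability.RandomPlanarGeometry.SAW

namespace BlockModule

/-! ### Part A — block algebra: a pure real-sequence lemma (no lattice) -/

section Algebra

variable {B I : ℕ → ℝ} {a : ℕ → ℕ → ℝ}

/-! Throughout Part A, `a n h` stands for the iterated renewal coefficient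
`a_n(h) = I_h + Σ_{k=1}^{n} B_k I_{h-k}` (hypothesis `ha`; so that
`a_{t-1}(h) = Σ_{k<t} u_k I_{h-k}` with `u_0 = 1`, `u_k = B_k`). -/

/-- `a_0(h) = I_h`. [folklore] -/
theorem coeff_zero (ha : ∀ n h, a n h = I h + ∑ k ∈ Finset.Icc 1 n, B k * I (h - k))
    (h : ℕ) : a 0 h = I h := by
  simp [ha]

/-- `a_{n+1}(h) = a_n(h) + B_{n+1} I_{h-n-1}`. [folklore] -/
theorem coeff_succ (ha : ∀ n h, a n h = I h + ∑ k ∈ Finset.Icc 1 n, B k * I (h - k))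
    (n h : ℕ) : a (n + 1) h = a n h + B (n + 1) * I (h - (n + 1)) := by
  rw [ha, ha, Finset.sum_Icc_succ_top (by omega : 1 ≤ n + 1)]
  ring

/-- `a_n(h) ≥ 0`. [folklore] -/
theorem coeff_nonneg (ha : ∀ n h, a n h = I h + ∑ k ∈ Finset.Icc 1 n, B k * I (h - k))
    (hB : ∀ n, 1 ≤ n → 0 ≤ B n) (hI : ∀ n, 0 ≤ I n) (n h : ℕ) : 0 ≤ a n h := by
  rw [ha]
  exact add_nonneg (hI h)
    (Finset.sum_nonneg fun k hk => mul_nonneg (hB k (Finset.mem_Icc.1 hk).1) (hI _))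

/-- **Iterated renewal equation** (Kesten): `B_s = a_n(s) + Σ_{k=1}^{s-n-1} B_k a_n(s-k)` for
`s ≥ n + 1`, by induction on `n` from the renewal equation
`B_s = I_s + Σ_{k=1}^{s-1} B_k I_{s-k}`. [folklore] -/
theorem iterate (ha : ∀ n h, a n h = I h + ∑ k ∈ Finset.Icc 1 n, B k * I (h - k))
    (hren : ∀ s, 1 ≤ s → B s = I s + ∑ k ∈ Finset.Icc 1 (s - 1), B k * I (s - k))
    (n : ℕ) : ∀ s, n + 1 ≤ s →
      B s = a n s + ∑ k ∈ Finset.Icc 1 (s - (n + 1)), B k * a n (s - k) := by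
  induction n with
  | zero =>
    intro s hs
    simp only [coeff_zero ha, Nat.zero_add]
    exact hren s hs
  | succ n ih =>
    intro s hs
    obtain ⟨m, rfl⟩ : ∃ m, s = m + 1 + (n + 1) := ⟨s - (n + 2), by omega⟩
    have e1 : m + 1 + (n + 1) - (n + 1 + 1) = m := by omega
    have e2 : m + 1 + (n + 1) - (n + 1) = m + 1 := by omega
    rw [e1]
    have h1 := ih (m + 1 + (n + 1)) (by omega)
    rw [e2, Finset.sum_Icc_succ_top (by omega : 1 ≤ m + 1),
      show m + 1 + (n + 1) - (m + 1) = n + 1 by omega] at h1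
    have h2 : a n (n + 1) = B (n + 1) := by
      rw [ha, hren (n + 1) (by omega)]
      simp
    have h3 := hren (m + 1) (by omega)
    simp only [Nat.add_sub_cancel] at h3
    simp only [coeff_succ ha]
    rw [e2]
    have h4 : ∀ k ∈ Finset.Icc 1 m,
        B k * (a n (m + 1 + (n + 1) - k) + B (n + 1) * I (m + 1 + (n + 1) - k - (n + 1))) =
          B k * a n (m + 1 + (n + 1) - k) + B (n + 1) * (B k * I (m + 1 - k)) := by
      intro k hk
      rw [show m + 1 + (n + 1) - k - (n + 1) = m + 1 - k by omega]
      ring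
    rw [Finset.sum_congr rfl h4, Finset.sum_add_distrib, ← Finset.mul_sum, h1, h2, h3]
    ring

/-- Shifted partial sums of a nonnegative sequence: `Σ_{s=t+k}^{N} f(s-k) ≤ Σ_{h=t}^{N} f(h)`.
[folklore] -/
theorem sum_shift_le (f : ℕ → ℝ) (hf : ∀ h, 0 ≤ f h) (t N k : ℕ) :
    ∑ s ∈ Finset.Icc (t + k) N, f (s - k) ≤ ∑ h ∈ Finset.Icc t N, f h := by
  classical
  calc ∑ s ∈ Finset.Icc (t + k) N, f (s - k)
      = ∑ h ∈ (Finset.Icc (t + k) N).image (fun s => s - k), f h := by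
        rw [Finset.sum_image]
        intro x hx y hy (hxy : x - k = y - k)
        simp only [Finset.coe_Icc, Set.mem_Icc] at hx hy
        omega
    _ ≤ ∑ h ∈ Finset.Icc t N, f h :=
        Finset.sum_le_sum_of_subset_of_nonneg (fun h hh => by
          simp only [Finset.mem_image, Finset.mem_Icc] at hh ⊢
          obtain ⟨s, hs, rfl⟩ := hh
          omega) (fun _ _ _ => hf _)

/-- **Block algebra** (Kesten 1963; Madras–Slade 1993 §4.2, with the second-moment bound replaced
by the exact block identity): if `B, I ≥ 0`, `B_1 > 0`, `B_s = I_s + Σ_{k=1}^{s-1} B_k I_{s-k}`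
for `s ≥ 1` and `p₀ Σ_{s=1}^{t} B_s ≤ Σ_{s=t}^{2t} B_s` (`t ≥ 1`), then
`p₀ B_1/(1+B_1) ≤ Σ_{h=t}^{2t} (I_h + Σ_{k=1}^{t-1} B_k I_{h-k})`. [folklore] -/
theorem block_algebra (hB : ∀ n, 1 ≤ n → 0 ≤ B n) (hI : ∀ n, 0 ≤ I n) (hB1 : 0 < B 1)
    {p₀ : ℝ} (hp₀ : 0 < p₀)
    (hren : ∀ s, 1 ≤ s → B s = I s + ∑ k ∈ Finset.Icc 1 (s - 1), B k * I (s - k))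
    {t : ℕ} (ht : 1 ≤ t)
    (hblock : p₀ * ∑ s ∈ Finset.Icc 1 t, B s ≤ ∑ s ∈ Finset.Icc t (2 * t), B s) :
    p₀ * B 1 / (1 + B 1) ≤
      ∑ h ∈ Finset.Icc t (2 * t), (I h + ∑ k ∈ Finset.Icc 1 (t - 1), B k * I (h - k)) := by
  obtain ⟨n, rfl⟩ : ∃ n, t = n + 1 := ⟨t - 1, by omega⟩
  simp only [Nat.add_sub_cancel]
  set a : ℕ → ℕ → ℝ := fun n h => I h + ∑ k ∈ Finset.Icc 1 n, B k * I (h - k)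
    with ha_def
  have ha : ∀ n h, a n h = I h + ∑ k ∈ Finset.Icc 1 n, B k * I (h - k) := fun _ _ => rfl
  change p₀ * B 1 / (1 + B 1) ≤ ∑ h ∈ Finset.Icc (n + 1) (2 * (n + 1)), a n h
  set A := ∑ h ∈ Finset.Icc (n + 1) (2 * (n + 1)), a n h with hA_def
  set U := ∑ s ∈ Finset.Icc 1 (n + 1), B s with hU_def
  have hA : 0 ≤ A := Finset.sum_nonneg fun h _ => coeff_nonneg ha hB hI n h
  have hU : B 1 ≤ U :=
    Finset.single_le_sum (f := B) (fun k hk => hB k (Finset.mem_Icc.1 hk).1)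
      (Finset.mem_Icc.2 ⟨le_rfl, by omega⟩)
  have hkey : ∑ s ∈ Finset.Icc (n + 1) (2 * (n + 1)), B s ≤ A * (1 + U) := by
    calc ∑ s ∈ Finset.Icc (n + 1) (2 * (n + 1)), B s
        = ∑ s ∈ Finset.Icc (n + 1) (2 * (n + 1)),
            (a n s + ∑ k ∈ Finset.Icc 1 (s - (n + 1)), B k * a n (s - k)) :=
          Finset.sum_congr rfl fun s hs => iterate ha hren n s (Finset.mem_Icc.1 hs).1
      _ = A + ∑ s ∈ Finset.Icc (n + 1) (2 * (n + 1)),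
            ∑ k ∈ Finset.Icc 1 (s - (n + 1)), B k * a n (s - k) := by
          rw [Finset.sum_add_distrib]
      _ = A + ∑ k ∈ Finset.Icc 1 (n + 1),
            ∑ s ∈ Finset.Icc (n + 1 + k) (2 * (n + 1)), B k * a n (s - k) := by
          congr 1
          exact Finset.sum_comm' fun s k => by simp only [Finset.mem_Icc]; omega
      _ ≤ A + ∑ k ∈ Finset.Icc 1 (n + 1), B k * A := by
          refine add_le_add le_rfl (Finset.sum_le_sum fun k hk => ?_)
          rw [← Finset.mul_sum]
          exact mul_le_mul_of_nonneg_left (sum_shift_le _ (coeff_nonneg ha hB hI n) _ _ _)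
            (hB k (Finset.mem_Icc.1 hk).1)
      _ = A * (1 + U) := by rw [← Finset.sum_mul]; ring
  have h1 : p₀ * U ≤ A * (1 + U) := hblock.trans hkey
  have hU0 : 0 < U := hB1.trans_le hU
  rw [div_le_iff₀ (by linarith)]
  have h3 : p₀ * B 1 ≤ p₀ * U := mul_le_mul_of_nonneg_left hU hp₀.le
  have h4 : p₀ * U * (1 + B 1) ≤ A * (1 + U) * (1 + B 1) :=
    mul_le_mul_of_nonneg_right h1 (by linarith)
  have h5 : p₀ * B 1 * (1 + U) ≤ A * (1 + B 1) * (1 + U) := by nlinarith [h3, h4]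
  exact le_of_mul_le_mul_right h5 (by linarith)

end Algebra

/-! ### Part B — limits `V → ∞` of the confined bridge masses and assembly -/

/-- `irrMassOf kernel ≥ 0`. [folklore] -/
theorem irrMassOf_nonneg (m p : ℤ) (h W : ℕ) : 0 ≤ irrMassOf kernel m p h W :=
  Finset.sum_nonneg fun _ _ => kernel_nonneg _ _ _ _ _ _

/-- `bridgeMassOf kernel ≥ 0`. [folklore] -/
theorem bridgeMassOf_nonneg (m p : ℤ) (h W : ℕ) : 0 ≤ bridgeMassOf kernel m p h W :=
  Finset.sum_nonneg fun _ _ => kernel_nonneg _ _ _ _ _ _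

/-- Monotonicity of window sums of a window-monotone nonnegative family. [folklore] -/
theorem sum_window_mono {f g : ℤ → ℝ} {V V' : ℕ} (hVV' : V ≤ V') (hg : ∀ j, 0 ≤ g j)
    (hfg : ∀ j, f j ≤ g j) :
    ∑ j ∈ Finset.Icc (-(V : ℤ)) V, f j ≤ ∑ j ∈ Finset.Icc (-(V' : ℤ)) V', g j :=
  (Finset.sum_le_sum fun j _ => hfg j).trans
    (Finset.sum_le_sum_of_subset_of_nonneg (Finset.Icc_subset_Icc (by omega) (by omega))
      fun j _ _ => hg j)

/-! Below, Kesten's irreducible-bridge masses are `I_n := ⨆ V, irrMassOf kernel 0 0 n V`; for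
`n ≥ 1` the supremum of a bounded monotone sequence (`irr_le`), for `n = 0` never used. -/

/-- `I_n ≥ 0`. [folklore] -/
theorem iSup_irr_nonneg (n : ℕ) : 0 ≤ ⨆ V : ℕ, irrMassOf kernel 0 0 n V :=
  Real.iSup_nonneg fun _ => irrMassOf_nonneg _ _ _ _

section Dictionary

variable (hD : BridgeDictionary kernel HV.stripBlim)
include hD

/-- `V ↦ bridgeMassOf kernel 0 0 k V` is monotone (dictionary (ii)). [folklore] -/
theorem bridge_mono (k : ℕ) : Monotone fun V => bridgeMassOf kernel 0 0 k V :=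
  fun V V' h => sum_window_mono h (fun _ => kernel_nonneg _ _ _ _ _ _)
    fun j => hD.2.1 0 0 k V V' k j h

/-- `V ↦ irrMassOf kernel 0 0 n V` is monotone (dictionary (ii)). [folklore] -/
theorem irr_mono (n : ℕ) : Monotone fun V => irrMassOf kernel 0 0 n V :=
  fun V V' h => sum_window_mono h (fun _ => kernel_nonneg _ _ _ _ _ _)
    fun j => hD.2.1 0 0 1 V V' n j h

/-- `B_n ≥ 0` for `n ≥ 1` (dictionary (iii) and `kernel ≥ 0`). [folklore] -/
theorem stripBlim_nonneg_of_dictionary (n : ℕ) (hn : 1 ≤ n) : 0 ≤ HV.stripBlim n :=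
  (bridgeMassOf_nonneg 0 0 n 0).trans (hD.2.2.1 n 0 hn)

/-- Translation invariance inside the `k`-sums: the upper piece stands on the door `(k, j)`,
which is a genuine door (`(j - k) % 2 = 0`) whenever the lower kernel is nonzero
(dictionary (v), then (i)). [folklore] -/
theorem translate (k : ℕ) (j : ℤ) (V n W : ℕ) :
    kernel 0 0 k V k j * irrMassOf kernel (0 + k) (0 + j) n W =
      kernel 0 0 k V k j * irrMassOf kernel 0 0 n W := by
  by_cases hq : (0 + j - (0 + (k : ℤ))) % 2 = 0
  · congr 1
    unfold irrMassOf
    exact Finset.sum_congr rfl fun j' _ => hD.1 _ _ _ _ _ _ hq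
  · rw [hD.2.2.2.2 0 0 k V k j hq, zero_mul, zero_mul]

/-- Summed form of `translate`:
`Σ_j κ(0,0; k,V,k,j) · irr(k,j; n,W) = bridge(0,0; k,V) · irr(0,0; n,W)`. [folklore] -/
theorem sum_translate (k V n W : ℕ) :
    ∑ j ∈ Finset.Icc (-(V : ℤ)) V, kernel 0 0 k V k j * irrMassOf kernel (0 + k) (0 + j) n W =
      bridgeMassOf kernel 0 0 k V * irrMassOf kernel 0 0 n W := by
  rw [Finset.sum_congr rfl fun j _ => translate hD k j V n W, ← Finset.sum_mul]
  rfl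

/-- `bridgeMassOf kernel 0 0 k V → B_k` as `V → ∞` (monotone, bounded by and approximating
`B_k`: dictionary (ii)–(iv)). [folklore] -/
theorem bridge_tendsto {k : ℕ} (hk : 1 ≤ k) :
    Tendsto (fun V => bridgeMassOf kernel 0 0 k V) atTop (𝓝 (HV.stripBlim k)) := by
  have hbdd : BddAbove (Set.range fun V => bridgeMassOf kernel 0 0 k V) :=
    ⟨_, by rintro _ ⟨V, rfl⟩; exact hD.2.2.1 k V hk⟩
  have hsup : (⨆ V, bridgeMassOf kernel 0 0 k V) = HV.stripBlim k := by
    refine le_antisymm (ciSup_le fun V => hD.2.2.1 k V hk)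
      (le_of_forall_sub_le fun ε hε => ?_)
    obtain ⟨W, hW⟩ := hD.2.2.2.1 k hk ε hε
    exact hW.trans (le_ciSup hbdd W)
  rw [← hsup]
  exact tendsto_atTop_ciSup (bridge_mono hD k) hbdd

variable (hS : RenewalSurgery kernel)
include hS

/-- Surgery (A) at the door `(0,0)`, translated: for `1 ≤ t ≤ h`,
`irr(h,V) + Σ_{k=1}^{t-1} bridge(k,V) irr(h-k,V) ≤ Σ_{|j| ≤ 2V} κ_t(2V; h, j)`. [folklore] -/
theorem surgery_concat {t h : ℕ} (ht : 1 ≤ t) (hth : t ≤ h) (V : ℕ) :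
    irrMassOf kernel 0 0 h V + ∑ k ∈ Finset.Icc 1 (t - 1),
        bridgeMassOf kernel 0 0 k V * irrMassOf kernel 0 0 (h - k) V ≤
      ∑ j ∈ Finset.Icc (-((2 * V : ℕ) : ℤ)) ((2 * V : ℕ) : ℤ),
        kernel 0 0 t (2 * V) h j := by
  have := hS.1 0 0 t V h (by norm_num) ht hth
  simpa only [sum_translate hD] using this

/-- Surgery (B) at the door `(0,0)`, translated: for `s ≥ 1`,
`bridge(s,W) ≤ irr(s,W) + Σ_{k=1}^{s-1} bridge(k,W) irr(s-k,2W)`. [folklore] -/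
theorem surgery_split {s : ℕ} (hs : 1 ≤ s) (W : ℕ) :
    bridgeMassOf kernel 0 0 s W ≤ irrMassOf kernel 0 0 s W + ∑ k ∈ Finset.Icc 1 (s - 1),
      bridgeMassOf kernel 0 0 k W * irrMassOf kernel 0 0 (s - k) (2 * W) := by
  have := hS.2 0 0 s W (by norm_num) hs
  simpa only [sum_translate hD] using this

/-- `irr(n,V) ≤ B_n` for `n ≥ 1` (surgery (A) at `t = h = n` and dictionary (iii)).
[folklore] -/
theorem irr_le {n : ℕ} (hn : 1 ≤ n) (V : ℕ) :
    irrMassOf kernel 0 0 n V ≤ HV.stripBlim n := by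
  have h := surgery_concat hD hS hn le_rfl V
  have h0 : 0 ≤ ∑ k ∈ Finset.Icc 1 (n - 1),
      bridgeMassOf kernel 0 0 k V * irrMassOf kernel 0 0 (n - k) V :=
    Finset.sum_nonneg fun k _ =>
      mul_nonneg (bridgeMassOf_nonneg _ _ _ _) (irrMassOf_nonneg _ _ _ _)
  have h2 : (∑ j ∈ Finset.Icc (-((2 * V : ℕ) : ℤ)) ((2 * V : ℕ) : ℤ),
      kernel 0 0 n (2 * V) n j) ≤ HV.stripBlim n :=
    hD.2.2.1 n (2 * V) hn
  linarith

/-- `(irr(n,V))_V` is bounded above for `n ≥ 1`. [folklore] -/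
theorem irr_bdd {n : ℕ} (hn : 1 ≤ n) :
    BddAbove (Set.range fun V => irrMassOf kernel 0 0 n V) :=
  ⟨_, by rintro _ ⟨V, rfl⟩; exact irr_le hD hS hn _⟩

/-- `irr(n,V) ≤ I_n` for `n ≥ 1`. [folklore] -/
theorem irr_le_iSup {n : ℕ} (hn : 1 ≤ n) (V : ℕ) :
    irrMassOf kernel 0 0 n V ≤ ⨆ V : ℕ, irrMassOf kernel 0 0 n V :=
  le_ciSup (irr_bdd hD hS hn) V

/-- `irr(n,V) → I_n` as `V → ∞` for `n ≥ 1`. [folklore] -/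
theorem irr_tendsto {n : ℕ} (hn : 1 ≤ n) :
    Tendsto (fun V => irrMassOf kernel 0 0 n V) atTop
      (𝓝 (⨆ V : ℕ, irrMassOf kernel 0 0 n V)) :=
  tendsto_atTop_ciSup (irr_mono hD n) (irr_bdd hD hS hn)

/-- **Kesten's renewal equation** `B_s = I_s + Σ_{k=1}^{s-1} B_k I_{s-k}` (`s ≥ 1`): `≤` from
surgery (B) and dictionary (iv), `≥` from surgery (A) at `t = h = s` in the limit `V → ∞`.
[folklore] -/
theorem renewal {s : ℕ} (hs : 1 ≤ s) :
    HV.stripBlim s = (⨆ V : ℕ, irrMassOf kernel 0 0 s V) +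
      ∑ k ∈ Finset.Icc 1 (s - 1),
        HV.stripBlim k * ⨆ V : ℕ, irrMassOf kernel 0 0 (s - k) V := by
  apply le_antisymm
  · refine le_of_forall_sub_le fun ε hε => ?_
    obtain ⟨W, hW⟩ := hD.2.2.2.1 s hs ε hε
    refine hW.trans ((surgery_split hD hS hs W).trans ?_)
    refine add_le_add (irr_le_iSup hD hS hs W) (Finset.sum_le_sum fun k hk => ?_)
    have hk := Finset.mem_Icc.1 hk
    exact mul_le_mul (hD.2.2.1 k W hk.1) (irr_le_iSup hD hS (by omega) _)
      (irrMassOf_nonneg _ _ _ _) (stripBlim_nonneg_of_dictionary hD k hk.1)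
  · have hlim : Tendsto (fun V => irrMassOf kernel 0 0 s V + ∑ k ∈ Finset.Icc 1 (s - 1),
        bridgeMassOf kernel 0 0 k V * irrMassOf kernel 0 0 (s - k) V) atTop
        (𝓝 ((⨆ V : ℕ, irrMassOf kernel 0 0 s V) + ∑ k ∈ Finset.Icc 1 (s - 1),
          HV.stripBlim k * ⨆ V : ℕ, irrMassOf kernel 0 0 (s - k) V)) :=
      (irr_tendsto hD hS hs).add (tendsto_finsetSum _ fun k hk =>
        (bridge_tendsto hD (Finset.mem_Icc.1 hk).1).mul
          (irr_tendsto hD hS (by have := Finset.mem_Icc.1 hk; omega)))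
    exact le_of_tendsto' hlim fun V =>
      (surgery_concat hD hS hs le_rfl V).trans (hD.2.2.1 s (2 * V) hs)

/-- **Finite window**: for `t ≥ 1`, the translated left side of surgery (A) summed over
`h ∈ [t, 2t]` is at most `boxMass 0 0 t (2V)`. [folklore] -/
theorem window {t : ℕ} (ht : 1 ≤ t) (V : ℕ) :
    ∑ h ∈ Finset.Icc t (2 * t), (irrMassOf kernel 0 0 h V + ∑ k ∈ Finset.Icc 1 (t - 1),
        bridgeMassOf kernel 0 0 k V * irrMassOf kernel 0 0 (h - k) V) ≤
      boxMass 0 0 t (2 * V) := by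
  unfold boxMass
  exact Finset.sum_le_sum fun h hh => surgery_concat hD hS ht (Finset.mem_Icc.1 hh).1 V

/-- The finite window converges to `Σ_{h=t}^{2t} (I_h + Σ_{k=1}^{t-1} B_k I_{h-k})` as
`V → ∞`. [folklore] -/
theorem window_tendsto {t : ℕ} (ht : 1 ≤ t) :
    Tendsto (fun V => ∑ h ∈ Finset.Icc t (2 * t), (irrMassOf kernel 0 0 h V +
        ∑ k ∈ Finset.Icc 1 (t - 1),
          bridgeMassOf kernel 0 0 k V * irrMassOf kernel 0 0 (h - k) V))
      atTop (𝓝 (∑ h ∈ Finset.Icc t (2 * t), ((⨆ V : ℕ, irrMassOf kernel 0 0 h V) +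
        ∑ k ∈ Finset.Icc 1 (t - 1),
          HV.stripBlim k * ⨆ V : ℕ, irrMassOf kernel 0 0 (h - k) V))) := by
  refine tendsto_finsetSum _ fun h hh => ?_
  have hh' := Finset.mem_Icc.1 hh
  refine (irr_tendsto hD hS (by omega)).add (tendsto_finsetSum _ fun k hk => ?_)
  have hk' := Finset.mem_Icc.1 hk
  exact (bridge_tendsto hD hk'.1).mul (irr_tendsto hD hS (by omega))

end Dictionary

end BlockModule

open BlockModule in
/-- **Stub 3c — the block module**: dictionary + surgery + `RenewalBlock p₀ t₀` ⟹
`BoxMassFloor` (Kesten's finitary renewal identity and block counting; no measure theory): with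
`c₀ = p₀ B_1 / (1 + B_1)`, for every `t ≥ max t₀ 1` some doubled window `2V` has
`boxMass 0 0 t (2V) ≥ c₀ / 2`, transported to every door by translation invariance.
[folklore] -/
theorem stub_blockModule :
    BridgeDictionary kernel HV.stripBlim → RenewalSurgery kernel →
      ∀ (p₀ : ℝ) (t₀ : ℕ), 0 < p₀ →
        (∀ t : ℕ, t₀ ≤ t →
          p₀ * ∑ s ∈ Finset.Icc 1 t, HV.stripBlim s ≤
            ∑ s ∈ Finset.Icc t (2 * t), HV.stripBlim s) →
        BoxMassFloor boxMass := by
  intro hD hS p₀ t₀ hp₀ hblock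
  have hB1 : 0 < HV.stripBlim 1 := stripBlim_one_pos DuminilCopinSmirnov2012_lemma2_holds
  set c₀ : ℝ := p₀ * HV.stripBlim 1 / (1 + HV.stripBlim 1) with hc₀_def
  have hc₀ : 0 < c₀ := div_pos (mul_pos hp₀ hB1) (by linarith)
  refine ⟨c₀ / 2, half_pos hc₀, max t₀ 1, fun t ht => ?_⟩
  have ht₀ : t₀ ≤ t := le_trans (le_max_left _ _) ht
  have ht1 : 1 ≤ t := le_trans (le_max_right _ _) ht
  have halg : c₀ ≤ ∑ h ∈ Finset.Icc t (2 * t), ((⨆ V : ℕ, irrMassOf kernel 0 0 h V) +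
      ∑ k ∈ Finset.Icc 1 (t - 1),
        HV.stripBlim k * ⨆ V : ℕ, irrMassOf kernel 0 0 (h - k) V) :=
    block_algebra (B := HV.stripBlim) (I := fun n => ⨆ V : ℕ, irrMassOf kernel 0 0 n V)
      (stripBlim_nonneg_of_dictionary hD) iSup_irr_nonneg hB1 hp₀
      (fun s hs => renewal hD hS hs) ht1 (hblock t ht₀)
  obtain ⟨V, hV⟩ :=
    ((window_tendsto hD hS ht1).eventually_const_lt ((half_lt_self hc₀).trans_le halg)).exists
  refine ⟨2 * V, fun m p hpar => ?_⟩
  have htrans : boxMass m p t (2 * V) = boxMass 0 0 t (2 * V) :=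
    Finset.sum_congr rfl fun h _ => Finset.sum_congr rfl fun j _ => hD.1 m p t (2 * V) h j hpar
  rw [htrans]
  exact hV.le.trans (window hD hS ht1 V)

end Summit.CriticalPhenomena.SAWScalingLimit.Theorems.MassRatio.Renewal
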